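import Literature.AnabelianGeometry.EtaleTheta.FrobenioidThetaDivisorSupportNegative
import Literature.AnabelianGeometry.EtaleTheta.ThetaFrobenioidOfTempered

/-!
# [EtTh] §5 vocabulary records: inhabitation census of `DivisorPrimeData` (Prop. 5.3) and `VocabParams` (Prop. 5.1)

Mochizuki, *The étale theta function and its Frobenioid-theoretic manifestations*, Publ. RIMS **45**
(2009), §5: Proposition 5.3, PRIMS p.325 (PDF p.99) — "the natural surjection
`Prime(Φ(A_⊚))^csp ↠ Prime(Φ(A_⊚))^ncsp`", "the natural bijection `Prime(Φ(A_⊚))^ncsp ⥲ ℤ`" (the special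
fibre of `Ÿ` being "an infinite chain of copies of the projective line, joined to one another at the points
'`0`' and '`∞`'", pp.324–325) [cite: MochizukiEtTh2009, Prop 5.3 p.325 (PDF p.99)]; Proposition 3.2 (i),
p.296 (PDF p.70): `DIV_+(Z^log_∞)^pf` "is a direct product of copies of `ℚ_{≥0}`, indexed by the cusps …
and irreducible components" [cite: MochizukiEtTh2009, Prop 3.2 (i) p.296 (PDF p.70)]; Proposition 5.1,
p.323 (PDF p.97) [cite: MochizukiEtTh2009, Prop 5.1 p.323 (PDF p.97)].

abc-iut cell, layer L2, non-vacuity row family NV-L2 (abc-iut-L2-lead RULINGS #9 R73 / #11 R82), seat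
abc-iut-w5-d034.  PROOF-ONLY companion (no `def`, no instance, no named fact) of abc-iut-L2-t4's
`FrobenioidThetaDivisors.DivisorPrimeData` (`FrobenioidThetaDivisors.lean`) and abc-iut-L2-t9's
`TemperedFrobenioid.VocabParams` (`ThetaFrobenioidOfTempered.lean`) — two of the zero-producer rows of
abc-iut-w5-d197's INHABITATION-CENSUS-L2-v1 (02:59Z kernel).  Companion rows `TObj`, `TemperedFilter` are
witnessed in abc-iut-w5-d118's `Discharge/Sec3TemperedFilterWitness.lean` (p424847) and are not repeated.

WHAT IS PROVED (kernel statements about OUR typed records; nothing about the mathematics of [EtTh]):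

* `DivisorPrimeData 𝔉` (for ANY §5 datum `𝔉 : ThetaFrobenioid C D`) is an INHABITATION CRITERION on the
  set of primes of the divisor monoid `Φ(A_⊚)` alone:
  - necessary: the non-cuspidal primes are in bijection with `ℤ` and the cuspidal primes surject onto them,
    so BOTH kinds are infinite (`DivisorPrimeData.infinite_ncspPrimes`; the cuspidal half is abc-iut-L6-d1's
    `infinite_setOf_isCuspidal`, consumed by name) and `Prime(Φ(A_⊚))` is infinite
    (`DivisorPrimeData.infinite_primes`); hence the record is EMPTY whenever `Φ(A_⊚)` has finitely many
    primes (`isEmpty_divisorPrimeData_of_finite`) — the case of every toy divisor monoid of the cell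
    (`ℕ`, `ℚ_{≥0}`: one prime; group-like monoids: none);
  - sufficient: as soon as `Prime(Φ(A_⊚)) ≃ ℤ ⊕ ℤ` ("cusps ⊔ irreducible components", the printed shape
    of `DIV_+(Ÿ_∞)`, Prop. 3.2 (i)) and the primary components `Φ(A_⊚)_𝔭` are pairwise isomorphic (as for
    a free / perfect-free monoid), the record is inhabited (`nonempty_divisorPrimeData_of_equiv`: cuspidal
    := the `inl`-primes, `cspToNcsp` and `ncspEquivZ` the evident bijections, `div(Θ̈)` a free slot).
  No landed `ThetaFrobenioid` is a closed term (its producers `ofBiKummerData` / `ofRootData` /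
  `ofThetaEnvData` / `ofTemperoidData` are all over genuine-style data), so no instance is asserted here:
  census class «CRITERION — needs the GENUINE divisor monoid of `Ÿ_∞`».
* `TemperedFrobenioid.VocabParams C₀` is a PARAMETER RECORD (three free `Prop` slots quoting the Prop. 5.1
  clauses whose vocabulary the tree does not define) and is inhabited for every `C₀`
  (`TemperedFrobenioid.nonempty_vocabParams`); nothing beyond the carrier is witnessed by that.

HONEST FRAMING: a zero census row is «not yet witnessed in OUR kernel», not «vacuous»; a criterion is
consistency information about the typed interface, not existence of the genuine object; nothing here bears
on, or takes a side on, [IUTchIII] Cor. 3.12; typed ≠ proved.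
-/

namespace Literature.AnabelianGeometry.EtaleTheta

open CategoryTheory
open Literature.AlgebraicGeometry.Frobenioids

universe w v v' u u'

/-! ### Primes: an element lies in the carrier of at most one prime -/

section Primes

variable {M : Type w} [CommMonoid M]

/-- An element of `M` lies in the carrier of at most one prime (the carrier of `𝔭` consists of the primary
elements whose `≼`-class IS `𝔭`; [FrdI] §0 p.12). [cite: MochizukiFrdI2008, §0 p.12] -/
theorem Primes.eq_of_mem_carrier {a : M} {𝔭 𝔮 : Primes M} (h𝔭 : a ∈ 𝔭.carrier) (h𝔮 : a ∈ 𝔮.carrier) :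
    𝔭 = 𝔮 := by
  obtain ⟨ha, rfl⟩ := h𝔭
  obtain ⟨ha', rfl⟩ := h𝔮
  rfl

/-- Every prime has an element in its carrier (a representative of the `≼`-class).
[cite: MochizukiFrdI2008, §0 p.12] -/
theorem Primes.carrier_nonempty (𝔭 : Primes M) : 𝔭.carrier.Nonempty := by
  induction 𝔭 using Quotient.inductionOn with
  | h a => exact ⟨a.1, a.2, rfl⟩

end Primes

namespace FrobenioidThetaDivisors

variable {C : Type u} [Category.{v} C] {D : Type u'} [Category.{v'} D] {𝔉 : ThetaFrobenioid.{w} C D}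

/-! ### Necessary conditions carried by any `DivisorPrimeData` -/

namespace DivisorPrimeData

/-- The non-cuspidal primes of `Φ(A_⊚)` are infinite: "the natural bijection `Prime(Φ(A_⊚))^ncsp ⥲ ℤ`"
(p.325 (PDF p.99)). [cite: MochizukiEtTh2009, Prop 5.3 p.325 (PDF p.99)] -/
theorem infinite_ncspPrimes (𝔓 : DivisorPrimeData 𝔉) :
    Infinite {p : Primes 𝔉.PhiAcirc // ¬ 𝔓.IsCuspidal p} :=
  𝔓.ncspEquivZ.infinite_iff.mpr inferInstance

/-- The cuspidal primes of `Φ(A_⊚)` are infinite (subtype form of abc-iut-L6-d1's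
`infinite_setOf_isCuspidal`: they surject onto the non-cuspidal ones, p.325 (PDF p.99)).
[cite: MochizukiEtTh2009, Prop 5.3 p.325 (PDF p.99)] -/
theorem infinite_cspPrimes (𝔓 : DivisorPrimeData 𝔉) :
    Infinite {p : Primes 𝔉.PhiAcirc // 𝔓.IsCuspidal p} :=
  Set.infinite_coe_iff.mpr (infinite_setOf_isCuspidal 𝔓)

/-- Hence `Prime(Φ(A_⊚))` is infinite for any inhabitant of the Prop. 5.3 record.
[cite: MochizukiEtTh2009, Prop 5.3 p.325 (PDF p.99)] -/
theorem infinite_primes (𝔓 : DivisorPrimeData 𝔉) : Infinite (Primes 𝔉.PhiAcirc) :=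
  haveI := 𝔓.infinite_ncspPrimes
  Infinite.of_injective (fun p : {p : Primes 𝔉.PhiAcirc // ¬ 𝔓.IsCuspidal p} => p.1)
    Subtype.val_injective

/-- Both kinds of primes occur: a non-cuspidal prime exists …
[cite: MochizukiEtTh2009, Prop 5.3 p.325 (PDF p.99)] -/
theorem exists_not_isCuspidal (𝔓 : DivisorPrimeData 𝔉) : ∃ p : Primes 𝔉.PhiAcirc, ¬ 𝔓.IsCuspidal p :=
  ⟨(𝔓.ncspEquivZ.symm 0).1, (𝔓.ncspEquivZ.symm 0).2⟩

/-- … and a cuspidal prime exists ("the natural surjection `Prime(Φ(A_⊚))^csp ↠ Prime(Φ(A_⊚))^ncsp`").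
[cite: MochizukiEtTh2009, Prop 5.3 p.325 (PDF p.99)] -/
theorem exists_isCuspidal (𝔓 : DivisorPrimeData 𝔉) : ∃ p : Primes 𝔉.PhiAcirc, 𝔓.IsCuspidal p := by
  obtain ⟨q, hq⟩ := 𝔓.cspToNcsp_surjective (𝔓.ncspEquivZ.symm 0)
  exact ⟨q.1, q.2⟩

end DivisorPrimeData

/-- **`DivisorPrimeData 𝔉` is EMPTY whenever `Φ(A_⊚)` has finitely many primes** — in particular over every
toy divisor monoid of the cell (`ℕ`, `ℚ_{≥0}`: a single prime; group-like monoids: no prime).  Kernel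
certificate for the NV-L2 census: the record needs the GENUINE divisor geometry of `Ÿ_∞` (infinitely many
cusps and irreducible components). [cite: MochizukiEtTh2009, Prop 5.3 p.325 (PDF p.99)] -/
theorem isEmpty_divisorPrimeData_of_finite [Finite (Primes 𝔉.PhiAcirc)] : IsEmpty (DivisorPrimeData 𝔉) :=
  ⟨fun 𝔓 => by
    haveI := 𝔓.infinite_primes
    exact not_finite (Primes 𝔉.PhiAcirc)⟩

/-- Variant: no `DivisorPrimeData` when `Φ(A_⊚)` has at most one prime (totally `≼`-ordered divisor
monoids such as `ℕ`, `ℚ_{≥0}`). [cite: MochizukiEtTh2009, Prop 5.3 p.325 (PDF p.99)] -/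
theorem isEmpty_divisorPrimeData_of_subsingleton [Subsingleton (Primes 𝔉.PhiAcirc)] :
    IsEmpty (DivisorPrimeData 𝔉) :=
  isEmpty_divisorPrimeData_of_finite

/-! ### Sufficient condition: `Prime(Φ(A_⊚)) ≃ ℤ ⊕ ℤ` with isomorphic primary components -/

/-- **Inhabitation of the Prop. 5.3 record from the printed SHAPE of the prime set.**  If the primes of
`Φ(A_⊚)` are in bijection with `ℤ ⊕ ℤ` — read "cusps ⊔ irreducible components of the special fibre of
`Ÿ`", both indexed by `ℤ` (pp.324–325 (PDF pp.98–99); Prop. 3.2 (i): `DIV_+` is the free (perfect) monoid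
on cusps ⊔ components) — and any two primary components `Φ(A_⊚)_𝔭` are isomorphic (as in a free or
perfect-free commutative monoid), then `DivisorPrimeData 𝔉` is inhabited: cuspidal := the `inl`-primes,
the surjection `csp ↠ ncsp` and the bijection `ncsp ⥲ ℤ` are the evident ones, the component
isomorphisms are the given ones, and `div(Θ̈)` (a free slot of the record) is set to `1`.  This is a
consistency statement about the typed record, not a construction of the divisor of `Θ̈`.
[cite: MochizukiEtTh2009, Prop 5.3 p.325 (PDF p.99)] -/
theorem nonempty_divisorPrimeData_of_equiv (e : Primes 𝔉.PhiAcirc ≃ ℤ ⊕ ℤ)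
    (hiso : ∀ p q : Primes 𝔉.PhiAcirc, Nonempty (p.submonoid ≃* q.submonoid)) :
    Nonempty (DivisorPrimeData 𝔉) := by
  classical
  -- cuspidal primes := those labelled on the left copy of `ℤ`
  let csp : Primes 𝔉.PhiAcirc → Prop := fun p => ∃ z : ℤ, e p = Sum.inl z
  -- the label of a prime, forgetting the side
  let lab : Primes 𝔉.PhiAcirc → ℤ := fun p => Sum.elim id id (e p)
  have hinr : ∀ z : ℤ, ¬ csp (e.symm (Sum.inr z)) := by
    rintro z ⟨z', hz'⟩
    rw [Equiv.apply_symm_apply] at hz'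
    exact Sum.inr_ne_inl hz'
  have hlab_inr : ∀ z : ℤ, lab (e.symm (Sum.inr z)) = z := fun z => by
    simp only [lab, Equiv.apply_symm_apply, Sum.elim_inr, id]
  have hlab_inl : ∀ z : ℤ, lab (e.symm (Sum.inl z)) = z := fun z => by
    simp only [lab, Equiv.apply_symm_apply, Sum.elim_inl, id]
  -- a non-cuspidal prime is labelled on the right
  have hncsp : ∀ p : Primes 𝔉.PhiAcirc, ¬ csp p → e p = Sum.inr (lab p) := by
    intro p hp
    rcases h : e p with z | z
    · exact (hp ⟨z, h⟩).elim
    · simp only [lab, h, Sum.elim_inr, id]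
  refine ⟨{ IsCuspidalElt := fun a => ∀ p : Primes 𝔉.PhiAcirc, a ∈ p.carrier → csp p
            IsNonCuspidalElt := fun a => ∀ p : Primes 𝔉.PhiAcirc, a ∈ p.carrier → ¬ csp p
            IsCuspidal := csp
            isCuspidal_iff := ?_
            ncspIso := fun p q _ _ => (hiso p q).some
            cspIso := fun p q _ _ => (hiso p q).some
            cspToNcsp := fun p => ⟨e.symm (Sum.inr (lab p.1)), hinr _⟩
            cspToNcsp_surjective := ?_
            ncspEquivZ :=
              { toFun := fun p => lab p.1
                invFun := fun z => ⟨e.symm (Sum.inr z), hinr z⟩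
                left_inv := ?_
                right_inv := fun z => hlab_inr z }
            divTheta := 1 }⟩
  · -- `isCuspidal_iff`: an element determines the prime whose carrier contains it
    intro p
    constructor
    · intro hp a ha q hq
      rwa [← Primes.eq_of_mem_carrier ha hq]
    · intro h
      obtain ⟨a, ha⟩ := Primes.carrier_nonempty p
      exact h a ha p ha
  · -- surjectivity of `csp ↠ ncsp`
    rintro ⟨q, hq⟩
    refine ⟨⟨e.symm (Sum.inl (lab q)), lab q, e.apply_symm_apply _⟩, Subtype.ext ?_⟩
    change e.symm (Sum.inr (lab (e.symm (Sum.inl (lab q))))) = q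
    rw [hlab_inl, ← hncsp q hq, Equiv.symm_apply_apply]
  · -- `ncsp ⥲ ℤ`, left inverse
    rintro ⟨q, hq⟩
    apply Subtype.ext
    change e.symm (Sum.inr (lab q)) = q
    rw [← hncsp q hq, Equiv.symm_apply_apply]

/-- Countable variant of the sufficient condition, phrased with two disjoint infinite countable families of
primes exhausting `Prime(Φ(A_⊚))`: if the primes split as `S ⊔ Sᶜ` with both parts countably infinite and
all primary components isomorphic, the record is inhabited (cuspidal := `S`).
[cite: MochizukiEtTh2009, Prop 5.3 p.325 (PDF p.99)] -/
theorem nonempty_divisorPrimeData_of_infinite_split (S : Set (Primes 𝔉.PhiAcirc))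
    [Countable (Primes 𝔉.PhiAcirc)] (hS : S.Infinite) (hSc : Sᶜ.Infinite)
    (hiso : ∀ p q : Primes 𝔉.PhiAcirc, Nonempty (p.submonoid ≃* q.submonoid)) :
    Nonempty (DivisorPrimeData 𝔉) := by
  classical
  -- both halves are countably infinite, hence in bijection with `ℤ`
  haveI : Infinite S := hS.to_subtype
  haveI : Infinite (Sᶜ : Set (Primes 𝔉.PhiAcirc)) := hSc.to_subtype
  obtain ⟨eS⟩ : Nonempty (S ≃ ℤ) := by
    haveI : Countable S := inferInstance
    exact ⟨(nonempty_equiv_of_countable (α := S) (β := ℤ)).some⟩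
  obtain ⟨eSc⟩ : Nonempty ((Sᶜ : Set (Primes 𝔉.PhiAcirc)) ≃ ℤ) := by
    exact ⟨(nonempty_equiv_of_countable (α := (Sᶜ : Set (Primes 𝔉.PhiAcirc))) (β := ℤ)).some⟩
  -- assemble `Prime ≃ S ⊕ Sᶜ ≃ ℤ ⊕ ℤ`
  have e : Primes 𝔉.PhiAcirc ≃ ℤ ⊕ ℤ := (Equiv.Set.sumCompl S).symm.trans (eS.sumCongr eSc)
  exact nonempty_divisorPrimeData_of_equiv e hiso

end FrobenioidThetaDivisors

/-! ### Prop. 5.1's parameter record `VocabParams` -/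

namespace TemperedFrobenioid

universe u₀ v₀ uD vD

variable {D₀ : Type u₀} [Category.{v₀} D₀] {V : FrdIMonoidStub.{w}}
  {T : RealifiedDivisorMonoids (D₀ := D₀) V} {DD : Type uD} [Category.{vD} DD]
  {VD : FrdICatStub.{uD, vD, w} DD}

/-- **`VocabParams C₀` is inhabited for every tempered-Frobenioid datum `C₀`** — it is a PARAMETER RECORD:
three free `Prop`-valued slots quoting the clauses of Prop. 5.1 whose vocabulary the tree does not define
("of rationally standard type", "all of the hypotheses of Corollary 3.8 (i)–(iii)", "… Theorem 4.4").
Honest label for the NV census: nothing beyond the carrier `C₀` is witnessed by this (the slots are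
instantiated with `True`; any reading may be substituted). [cite: MochizukiEtTh2009, Prop 5.1 p.323 (PDF p.97)] -/
theorem nonempty_vocabParams (C₀ : TemperedFrobenioid T DD VD) : Nonempty C₀.VocabParams :=
  ⟨{ IsRationallyStandard := True
     HypothesesCor38 := fun _ => True
     HypothesesThm44 := fun _ => True }⟩

/-- The parameter record with PRESCRIBED readings: any three predicates inhabit it (so a consumer who fixes
readings `P₁`, `P₂`, `P₃` of the three printed clauses gets the corresponding record).
[cite: MochizukiEtTh2009, Prop 5.1 p.323 (PDF p.97)] -/
theorem nonempty_vocabParams_of (C₀ : TemperedFrobenioid T DD VD) (P₁ : Prop)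
    (P₂ P₃ : (C₀.category ≌ C₀.category) → Prop) :
    ∃ P : C₀.VocabParams, P.IsRationallyStandard = P₁ ∧ P.HypothesesCor38 = P₂ ∧ P.HypothesesThm44 = P₃ :=
  ⟨{ IsRationallyStandard := P₁, HypothesesCor38 := P₂, HypothesesThm44 := P₃ }, rfl, rfl, rfl⟩

end TemperedFrobenioid

end Literature.AnabelianGeometry.EtaleTheta
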